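import Mathlib
import Summits.ResolutionOfSingularities.ResolutionOfSingularities.Theorems.RadicialJungCleanModelsPointChainCleanPermSeq
import Summits.ResolutionOfSingularities.ResolutionOfSingularities.Theorems.MarkedTransferCampaignW46ThreefoldsTauTwoSlice
import Literature.AlgebraicGeometry.Resolution.NearPointTauMonotone
import Literature.AlgebraicGeometry.Resolution.HironakaTauTransport
import HarnessLib

/-!
# Route `RadicialJung`, crux `CleanModels` (stmt-ResolutionOfSingularities-15917), line `Sketch` rev 35, stub 6 `stub_cleanProp44` (X44c):
# L7b's insertion chains over `τ ≥ 2` points create NO new bad points — the bad locus stays on the strict transform, `τ ≥ 2` persists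

Towards the clean REGULAR-CURVE slice of [CoP1] Prop. 4.4 in the sub-case «`τ ≥ 2` at the closed points of the curve» (in the W4.6 world this is one
blowing up, ✓ `CampaignW46.orderReducible_comap_of_curve_two_le_tau_closedPoints`; in the clean world the curve must first be made clean-permissible by
L7b's point blow-ups, ✓ `exists_isCleanPermissibleSeq_forall_cleanPermissibleAt_of_ncard_le`).  This file strengthens the chain lemma
✓ `IsPointChainAlong.isCleanPermissibleSeq` (p819379) by two invariants which say that the insertions are HARMLESS when `τ ≥ 2` along the curve:

* `IsPointChainAlong.isCleanPermissibleSeq_tau` — along a chain of point blow-ups following a regular curve `C₀` of the stratum `{ord J₁ = μ}` whose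
  CLOSED points all have Hironaka `τ ≥ 2`: (i) every point of order `≥ μ` of the iterated controlled transform OVER THE BASE POINT lies on the strict
  transform `C` (the near point over a `τ = 2` point is unique, ✓ `IsBlowup.eq_of_isNear_of_isNear_point`, and the point of `C` over it IS near, `C`
  lying in `{ord = μ}` by upper semicontinuity; `τ = 3` cannot occur on a curve of the stratum); (ii) the preimage of `C₀` minus the base point lies
  on `C`; (iii) `τ ≥ 2` at the closed points of `C` (off the centres ✓ `IsBlowup.stalkTau_controlledTransform_of_not_mem`; at the near point
  ✓ `IsBlowup.stalkTau_le_stalkTau_of_isNear_point`, [CoP1] Lemma 4.3 (3)).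

Honest framing: OURS (bookkeeping over the tree's near-point theory); nothing here proves X44c, any case of `CleanModels`, or resolution in characteristic `p`.
-/

noncomputable section

set_option linter.dupNamespace false -- mandated namespace of this single-conjunct summit

open CategoryTheory AlgebraicGeometry TopologicalSpace IsLocalRing Opposite
open Literature.AlgebraicGeometry.Resolution Literature.AlgebraicGeometry.Motives
open Scheme.IdealSheafData

namespace Summit.ResolutionOfSingularities.ResolutionOfSingularities.Theorems.RadicialJung.CleanModels

/-- A regular local ring of dimension `3` has embedding dimension `3`. [folklore] -/
private theorem spanFinrank_eq_three {R : Type} [CommRing R] [IsRegularLocalRing R] (h : ringKrullDim R = 3) :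
    (maximalIdeal R).spanFinrank = 3 := by
  have h1 := IsRegularLocalRing.spanFinrank_maximalIdeal (R := R)
  rw [h] at h1
  exact_mod_cast h1

set_option maxHeartbeats 800000 in
-- the near-point bookkeeping at the new stage is long (as in the W4.6 files)
/-- **A chain of point blow-ups following a `τ ≥ 2` curve of the `μ`-stratum: clean-permissible, and HARMLESS.**  Strengthening of
✓ `IsPointChainAlong.isCleanPermissibleSeq`: same hypotheses plus `μ ≥ 1` and `τ ≥ 2` at the closed points of `C₀`; same conclusions plus (i) points of
order `≥ μ` over the base point lie on the strict transform `C`, (ii) the preimage of `C₀` off the base point lies on `C`, (iii) `τ ≥ 2` at the closed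
points of `C`. [cite: CossartPiltant2008, Lemma 4.3 (1) (3); Prop. 4.2 (a)] [cite: Piltant2013, §2 Axiom 2 (ii)] -/
theorem IsPointChainAlong.isCleanPermissibleSeq_tau {p : ℕ} (hp : p.Prime) {X X₁ : Scheme.{0}} [IsIntegral X] [IsIntegral X₁]
    [IsNoetherian X₁] {π : X₁ ⟶ X} [IsDominant π] {J : X.IdealSheafData} {μ : ℕ} (hm : 1 ≤ μ) {J₁ : X₁.IdealSheafData}
    {G : X.functionField} [CharP X.functionField p]
    (hπ : IsCleanPermissibleSeq p π J μ J₁ G) (hG : ∀ x : X, CleanRegAt p (algebraMap (X.presheaf.stalk x) X.functionField) G)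
    (hX₁ : Scheme.IsRegular X₁) (hE₁ : Scheme.IsQuasiExcellent X₁) (hJ₁le : ∀ x : X₁, idealOrder J₁ x ≤ μ) {C₀ : Closeds X₁}
    (hC₀reg : ∀ y ∈ (C₀ : Set X₁), ∃ c : Fin 2 → X₁.presheaf.stalk y, IsRsopPart c ∧ Ideal.span (Set.range c) = stalkIdeal (vanishingIdeal C₀) y)
    (hC₀μ : ∀ y ∈ (C₀ : Set X₁), idealOrder J₁ y = μ)
    (hτC₀ : ∀ y ∈ (C₀ : Set X₁), IsClosed ({y} : Set X₁) → ∀ hr : IsRegularLocalRing (X₁.presheaf.stalk y), 2 ≤ @stalkTau X₁ J₁ y hr μ)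
    {X' : Scheme.{0}} [IsLocallyNoetherian X'] {σ : X' ⟶ X₁} {C : Closeds X'} {x : X'} {n : ℕ} (h : IsPointChainAlong σ C₀ C x n)
    (hxC₀ : σ x ∈ (C₀ : Set X₁)) (hdim₀ : ringKrullDim (X₁.presheaf.stalk (σ x)) = 3) (hx₀cl : IsClosed ({σ x} : Set X₁))
    (h0 : σ x ∈ closure ((C₀ : Set X₁) \ {σ x})) :
    ∃ (_ : IsIntegral X') (_ : IsDominant σ) (J' : X'.IdealSheafData), IsCleanPermissibleSeq p (σ ≫ π) J μ J' G ∧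
      (∀ x' : X', idealOrder J' x' ≤ μ) ∧ (∀ y ∈ (C : Set X'), idealOrder J' y = μ) ∧
      (∀ y : X', σ y ≠ σ x → idealOrder J' y = idealOrder J₁ (σ y)) ∧
      (∀ z : X', σ z = σ x → (μ : ℕ∞) ≤ idealOrder J' z → z ∈ (C : Set X')) ∧
      (∀ z : X', σ z ≠ σ x → σ z ∈ (C₀ : Set X₁) → z ∈ (C : Set X')) ∧
      (∀ y ∈ (C : Set X'), IsClosed ({y} : Set X') → ∀ hr : IsRegularLocalRing (X'.presheaf.stalk y), 2 ≤ @stalkTau X' J' y hr μ) := by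
  induction h with
  | nil C₀ x₀ =>
    refine ⟨inferInstance, inferInstance, J₁, by simpa using hπ, hJ₁le, hC₀μ, fun y _ => by simp, fun z hz _ => ?_, fun z _ hz => by simpa using hz,
      fun y hy hycl hr => by simpa using hτC₀ y hy hycl hr⟩
    have hz' : z = x₀ := by simpa using hz
    rw [hz']
    simpa using hxC₀
  | @cons Xm Xt _ _ σ C₀ C n τ x' hx hchain hYreg hτ hx' ih =>
    have hστ : (τ ≫ σ) x' = σ (τ x') := by rw [Scheme.Hom.comp_apply]
    rw [hστ] at hxC₀ hdim₀ hx₀cl h0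
    obtain ⟨hXint, hσdom, J', hseq, hle, hCμ, hoff, hfib, hpre, hτC⟩ := ih hC₀reg hC₀μ hτC₀ hxC₀ hdim₀ hx₀cl h0
    haveI := hXint
    haveI := hσdom
    obtain ⟨hXreg, hCreg, hxC, hdimx⟩ := data_along_pointChain hchain hX₁ hC₀reg hxC₀ hdim₀
    have hXE : Scheme.IsQuasiExcellent _ := hchain.isQuasiExcellent hE₁
    -- the centre ideal is nonzero
    have hYbot : vanishingIdeal (⟨{τ x'}, hx⟩ : Closeds _) ≠ ⊥ := by
      intro hbot
      obtain ⟨c, hc, hspan⟩ := hCreg (τ x') hxC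
      haveI := hc.1
      have hPle : stalkIdeal (vanishingIdeal C) (τ x') ≤ maximalIdeal _ :=
        (mem_support_iff_stalkIdeal_le _ _).mp
          (by rw [← SetLike.mem_coe, Scheme.IdealSheafData.coe_support_vanishingIdeal]; exact hxC)
      have hc0 : c 0 ∈ stalkIdeal (vanishingIdeal (⟨{τ x'}, hx⟩ : Closeds _)) (τ x') := by
        rw [stalkIdeal_vanishingIdeal_singleton hx]
        exact hPle (hspan ▸ Ideal.subset_span ⟨0, rfl⟩)
      rw [hbot, stalkIdeal_bot, Ideal.mem_bot] at hc0
      exact hc.ne_zero 0 hc0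
    haveI : IsIntegral _ := hτ.isIntegral hYbot
    haveI : IsDominant τ := isDominant_of_isBlowup_of_ne_bot hτ hYbot
    -- the new stage is Noetherian (for upper semicontinuity of the order)
    haveI : IsProper σ := hchain.isProper
    haveI : IsProper τ := hτ.isProper
    haveI : CompactSpace Xt := QuasiCompact.compactSpace_of_compactSpace (τ ≫ σ)
    haveI : IsNoetherian Xt := {}
    -- the step
    have hint := isIntegral_subscheme_vanishingIdeal_singleton hx
    have hord : idealOrder J' (τ x') = μ := hCμ _ hxC
    have key := IsCleanPermissibleSeq.cons_point hp τ (σ ≫ π) J μ J' G hseq (τ x') hx hint hYreg hord hτ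
      (hseq.cleanRegAt hp inferInstance hG (τ x'))
    set J'' := controlledTransform τ (vanishingIdeal (⟨{τ x'}, hx⟩ : Closeds _)) J' μ with hJ''
    -- orders of `J''`
    have hY : ∀ y ∈ ((⟨{τ x'}, hx⟩ : Closeds _) : Set _), idealOrder J' y = μ := by
      intro y hy
      have hy' : y = τ x' := hy
      subst hy'
      exact hord
    have hle'' : ∀ z, idealOrder J'' z ≤ μ := fun z => hτ.idealOrder_controlledTransform_le_of_forall hXreg hYreg hY hle z
    have hoff'' : ∀ z, τ z ≠ τ x' → idealOrder J'' z = idealOrder J' (τ z) := by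
      intro z hz
      refine hτ.idealOrder_controlledTransform_of_not_mem J' μ ?_
      rw [Scheme.IdealSheafData.coe_support_vanishingIdeal]
      exact hz
    have hne'' : J'' ≠ ⊥ := by
      intro hbot
      have h1 : ((μ + 1 : ℕ) : ℕ∞) ≤ idealOrder J'' x' := by
        rw [le_idealOrder_iff, hbot, stalkIdeal_bot]; exact bot_le
      have h2 : ((μ + 1 : ℕ) : ℕ∞) ≤ (μ : ℕ∞) := h1.trans (hle'' x')
      exact (not_le.mpr (by exact_mod_cast Nat.lt_succ_self μ)) h2
    have hX' : Scheme.IsRegular _ := (strictTransform_curve_data_of_isBlowup_point hXreg hx hYreg hτ hCreg hxC hdimx hx').1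
    have hclosed : IsClosed {z | (μ : ℕ∞) ≤ idealOrder J'' z} :=
      isClosed_setOf_le_idealOrder_of_isJ2 hX' (fun U => (hτ.isQuasiExcellent hXE U).2) hne'' μ
    have hCμ'' : ∀ y ∈ closure (τ ⁻¹' ((C : Set _) \ {τ x'})), idealOrder J'' y = μ := by
      have hsub : τ ⁻¹' ((C : Set _) \ {τ x'}) ⊆ {z | (μ : ℕ∞) ≤ idealOrder J'' z} := by
        rintro z ⟨hzC, hzx⟩
        change (μ : ℕ∞) ≤ idealOrder J'' z
        rw [hoff'' z hzx, hCμ _ hzC]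
      intro y hy
      exact le_antisymm (hle'' y) ((hclosed.closure_subset_iff.mpr hsub) hy)
    -- the closure of the preimage lies over `C`
    have hC'sub : closure (τ ⁻¹' ((C : Set _) \ {τ x'})) ⊆ τ ⁻¹' (C : Set _) :=
      closure_minimal (fun z hz => hz.1) (C.isClosed.preimage τ.continuous)
    -- NEAR-POINT DATA at the blown-up point `τ x'` (embedding dimension `3`, `τ = 2`)
    haveI hrx : IsRegularLocalRing (Xm.presheaf.stalk (τ x')) := hXreg (τ x')
    have hd : (maximalIdeal (Xm.presheaf.stalk (τ x'))).spanFinrank = 3 := spanFinrank_eq_three hdimx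
    obtain ⟨c3, hc3, hc3Y⟩ := CampaignW46.exists_rsop_three hx hd
    -- the new point `x'` of the strict transform is near
    have hnear_x' : IsNear τ (vanishingIdeal (⟨{τ x'}, hx⟩ : Closeds _)) J' μ x' := isNear_iff.mpr (hCμ'' x' hx')
    have hτ2 : stalkTau J' (τ x') μ = 2 :=
      le_antisymm (hτ.stalkTau_le_two_of_isNear_point hd hc3 hc3Y hnear_x') (hτC (τ x') hxC hx hrx)
    refine ⟨inferInstance, inferInstance, J'', by simpa only [Category.assoc] using key, hle'', hCμ'', fun y hy => ?_,
      fun z hz hzμ => ?_, fun z hz hzC₀ => ?_, fun y hy hycl hr => ?_⟩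
    · -- orders off the base point
      have hy' : σ (τ y) ≠ σ (τ x') := by
        intro heq; apply hy; rw [Scheme.Hom.comp_apply, Scheme.Hom.comp_apply, heq]
      have hne : τ y ≠ τ x' := fun heq => hy' (by rw [heq])
      rw [Scheme.Hom.comp_apply, hoff'' y hne, hoff _ hy']
    · -- (i) points of order `≥ μ` over the base point lie on the new strict transform
      rw [Scheme.Hom.comp_apply, Scheme.Hom.comp_apply] at hz
      by_cases hzx : τ z = τ x'
      · -- over the blown-up point: `z` is near, hence the unique near point `x'`
        have hnear_z : IsNear τ (vanishingIdeal (⟨{τ x'}, hx⟩ : Closeds _)) J' μ z := isNear_iff.mpr (le_antisymm (hle'' z) hzμ)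
        haveI : IsRegularLocalRing (Xm.presheaf.stalk (τ z)) := hXreg (τ z)
        haveI : IsRegularLocalRing (Xt.presheaf.stalk x') := hX' x'
        have heq : z = x' := hτ.eq_of_isNear_of_isNear_point hd hc3 hc3Y hτ2 hnear_x' hnear_z hzx
        rw [heq]
        exact hx'
      · -- off the blown-up point: the order is that of `J'` at `τ z`, a point over the base point, hence on `C`
        have hzμ' : (μ : ℕ∞) ≤ idealOrder J' (τ z) := by rw [← hoff'' z hzx]; exact hzμ
        exact subset_closure ⟨hfib (τ z) hz hzμ', hzx⟩
    · -- (ii) the preimage of `C₀` off the base point lies on the new strict transform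
      rw [Scheme.Hom.comp_apply, Scheme.Hom.comp_apply] at hz
      rw [Scheme.Hom.comp_apply] at hzC₀
      have hzx : τ z ≠ τ x' := fun heq => hz (by rw [heq])
      exact subset_closure ⟨hpre (τ z) hz hzC₀, hzx⟩
    · -- (iii) `τ ≥ 2` at the closed points of the new strict transform
      by_cases hyx : τ y = τ x'
      · -- the near point over the blown-up point: Lemma 4.3 (3)
        have hnear_y : IsNear τ (vanishingIdeal (⟨{τ x'}, hx⟩ : Closeds _)) J' μ y := isNear_iff.mpr (hCμ'' y hy)
        haveI : IsRegularLocalRing (Xm.presheaf.stalk (τ y)) := hXreg (τ y)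
        have hd' : (maximalIdeal (Xm.presheaf.stalk (τ y))).spanFinrank = 3 := by
          rw [CampaignW46.spanFinrank_maximalIdeal_congr hyx]; exact hd
        obtain ⟨c3', hc3', hc3Y'⟩ := CampaignW46.exists_rsop_three (by rw [hyx]; exact hx) hd'
        have hcl' : (⟨{τ y}, by rw [hyx]; exact hx⟩ : Closeds Xm) = ⟨{τ x'}, hx⟩ := Closeds.ext (by simp [hyx])
        rw [hcl'] at hc3Y'
        have hτ2' : stalkTau J' (τ y) μ = 2 := by
          rw [CampaignW46.stalkTau_congr hXreg J' μ hyx]; exact hτ2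
        have h1 := hτ.stalkTau_le_stalkTau_of_isNear_point (x' := y) hm hd' hc3' hc3Y' hτ2' hnear_y
        rw [hτ2'] at h1
        exact h1
      · -- off the centre: `τ` is unchanged, and `τ y` is a closed point of `C`
        have hyC : τ y ∈ (C : Set _) := hC'sub hy
        have hycl' : IsClosed ({τ y} : Set Xm) := by
          have := τ.isClosedMap _ hycl
          rwa [Set.image_singleton] at this
        haveI : IsRegularLocalRing (Xm.presheaf.stalk (τ y)) := hXreg (τ y)
        have hnot : τ y ∉ ((vanishingIdeal (⟨{τ x'}, hx⟩ : Closeds _)).support : Set Xm) := by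
          rw [Scheme.IdealSheafData.coe_support_vanishingIdeal]; exact hyx
        have h1 := hτ.stalkTau_controlledTransform_of_not_mem J' μ μ hnot (x' := y)
        rw [h1]
        exact hτC (τ y) hyC hycl' _

end Summit.ResolutionOfSingularities.ResolutionOfSingularities.Theorems.RadicialJung.CleanModels

end
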